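import Mathlib
import Literature.Computability.Complexity.CircuitClasses
import Literature.Computability.MetaComplexity.FormulaModelsAE
import Literature.Computability.MetaComplexity.XorBottomModelsAE
import Literature.Computability.MetaComplexity.BranchingPrograms
import Literature.Computability.MetaComplexity.ChenJinWilliams2019.SparseMagnification
import Literature.Computability.MetaComplexity.ChenJinWilliams2020.SparseProbabilisticFormulas
import Literature.Computability.MetaComplexity.OliveiraPichSanthanam2019.GapMKtPMagnification
import HarnessLib

/-!
# Chen–Jin–Williams 2019, Theorem 1.1 items 2–5 (`C = NP`): sparse `NP` languages vs
# `U₂-Formula-⊕[n^{1+ε}]`, `B₂-Formula[n^{2+ε}]`, `U₂-Formula[n^{3+ε}]`, `BP[n^{2+ε}]` — and their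
# printed converses — as named facts (census cell `pub-magnif`, row R48)

Citation header. L. Chen, C. Jin, R. R. Williams, *Hardness Magnification for all Sparse NP
Languages*, FOCS 2019, 1240–1255, doi:10.1109/FOCS.2019.00077 [bib: `ChenJinWilliams2019`]; full
version ECCC TR19-118 (held key `paper:url-5c604605311c`, same numbering). Companion of
`SparseMagnification.lean` (item 1, circuits). Printed (TR19-118 p. 3 L25 and p. 3 L39 – p. 4 L5,
verbatim):

*"We consider formulas over the De Morgan basis U₂ (NOT, AND(x,y), OR(x,y)), the basis of all
two-input Boolean functions B₂, and extended U₂-formulas where the leaves may be constants or parities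
over input bits of arbitrary arity. We denote the corresponding classes for formulas of at most s
leaves by U₂-Formula[s] (or simply Formula[s]), B₂-Formula[s], and U₂-Formula-⊕[s], respectively."*
*"The class BP[s] contains problems solvable by a family of (deterministic) branching programs of
size at most s(n)"*.

*"Theorem 1.1. Let C be any complexity class such that ∃·C = C (e.g., C = NP, MA, or AM). If there
is an ε > 0 and a family of languages {L_β} (indexed over β ∈ (0, 1)) such that L_β is a
2^{n^β}-sparse language in C and for all β: […] 2. L_β ∉ U₂-Formula-⊕[n^{1+ε}], then C ⊄ Formula[n^k]
for all k. 3. L_β ∉ B₂-Formula[n^{2+ε}], then C ⊄ Formula[n^k] for all k. 4. L_β ∉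
U₂-Formula[n^{3+ε}], then C ⊄ Formula[n^k] for all k. 5. L_β ∉ BP[n^{2+ε}], then C ⊄ BP[n^k] for
all k. […] Moreover, the converse of each item above also holds, except for the last two."* (the
last two = items 6, 7: `AC_d[m]`, `TC_d`; so items 2–5 all come WITH their converse). Proof in
print: §4, p. 14–15 ("The U₂-Formula, B₂-Formula, and U₂-Formula-⊕ cases", "The branching program
(BP) case": the kernel `H_t` of a `2^t`-sparse language, `t = n^β`, composed with parities).

## Rendering (each choice makes the vendored implication a consequence of the printed one)

* Models = the tree's ALMOST-EVERYWHERE classes: `FORMULAXORae s` (`U₂-Formula-⊕[s]`: De Morgan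
  formulas with parity / constant leaves, size = leaves, `XorBottomModelsAE.lean`), `B2FORMULAae s`
  (`B₂-Formula[s]`, leaves), `FORMULAae s` (`U₂-Formula[s]` = De Morgan formulas, leaves,
  `FormulaModelsAE.lean`), `BPSIZEae s` (deterministic branching programs, size = inner nodes,
  `BranchingPrograms.lean`); each constrains lengths `≥ n₀` only, so it CONTAINS the printed
  every-length class at the same `s`, and `L ∉ (a.e. class)` — "every admissible family fails at
  infinitely many lengths" — implies the printed `L ∉ Model[s]`. Thresholds `n^{a+ε}` are rounded UP
  (`powCeil (a+ε) n = ⌈n^{a+ε}⌉`; bigger class, stronger hypothesis). For `BP` the node/edge size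
  conventions differ by a factor `≤ 2`, absorbed on the hypothesis side by rounding up and on the
  conclusion side by `k ↦ k+1` below.
* Conclusions. "`C ⊄ Formula[n^k]` for all `k`" (for `C = NP`) is the tree's
  `ChenJinWilliams2020.NPNotInFixedPolyFormulas` (`∀ k, ∃ L ∈ NP, L ∉ FORMULAae (n ↦ n^k)`) and
  "`C ⊄ BP[n^k]` for all `k`" is `NPNotInFixedPolyBP` (`∀ k, ∃ L ∈ NP, L ∉ BPSIZEae (n ↦ n^k)`). The
  printed conclusion is read asymptotically (the only meaningful reading — with the every-length
  reading a single short length would witness it; cf. `SparseMagnification.lean`, docstring (i)):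
  print at `k+1` gives an `NP` language whose formula (resp. BP) complexity exceeds `n^{k+1} ≥ n^k`
  (resp. `≥ 2·n^k` edges, so `> n^k` nodes) at infinitely many lengths, i.e. ours at `k`. Conversely
  ours implies the printed conclusion (a.e. class ⊇ every-length class), and the printed converse at
  `ε` yields our hypothesis at `ε/2` (`⌈n^{a+ε/2}⌉ < n^{a+ε}` for large `n`), so the CONVERSE facts
  are also implied by print.
* Family `{L_β}` = `∀ β ∈ (0,1), ∃ L, …` (choice); sparsity `|L_n| ≤ ⌊2^{n^β}⌋` on `Set.ncard`
  (`ChenJinWilliams2019.IsSparse`, `expSparsity`), exactly as item 1.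
* HONEST FRAMING (census rule): every `thm11_item*` below is a THRESHOLD fact (T) and every
  `…_converse` makes the row an EQUIVALENCE with `NP ⊄ Formula[n^k] ∀ k` (resp. `NP ⊄ BP[n^k] ∀ k`)
  — census row R48 is a "⟺" row like R42/R43, not a numeric gap to be closed by a slightly better
  bound; the hypotheses `Sparse…HardAt ε` are OPEN lower bounds, recorded as `Prop`s, never asserted.
  KNOWN same-model bounds (print p. 4 L6–9: Håstad `n^{3−o(1)}` for `U₂`, Nečiporuk `n^{2−o(1)}` for
  `B₂`/`BP`, Tal's `n^{2−ε}`-type bounds for `U₂-Formula-⊕` — for DENSE explicit functions) are not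
  vendored here (other files / rows R1, R2, R16–R18).

## What is proved here (elementary)

Antitonicity of each hypothesis in `ε`; the four "iff" packagings; inhabitedness of every model class
at the thresholds (`headLang`), so that "`L ∉ class`" is a genuine lower-bound statement about `L` and
not an artefact of an empty class.
-/

noncomputable section

namespace Literature.Computability.MetaComplexity.ChenJinWilliams2019

open Literature.Computability.Complexity Literature.Computability.Complexity.Nondeterministic
open Literature.Computability.MetaComplexity

/-! ### Thresholds -/

/-- `⌈n^e⌉` — the size threshold `n^{a+ε}`, rounded up.
[cite: ChenJinWilliams2019, Thm. 1.1 (size parameters)] -/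
def powCeil (e : ℝ) (n : ℕ) : ℕ := ⌈(n : ℝ) ^ e⌉₊

/-- `powCeil` is monotone in the exponent (positive exponents). [folklore] -/
theorem powCeil_mono {e e' : ℝ} (he : 0 < e) (h : e ≤ e') (n : ℕ) : powCeil e n ≤ powCeil e' n := by
  unfold powCeil
  refine Nat.ceil_le_ceil ?_
  rcases Nat.eq_zero_or_pos n with hn | hn
  · subst hn
    simp [Real.zero_rpow he.ne', Real.zero_rpow (ne_of_gt (lt_of_lt_of_le he h))]
  · exact Real.rpow_le_rpow_of_exponent_le (by exact_mod_cast hn) h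

/-- `1 ≤ ⌈n^e⌉` for `n ≥ 1` and `e ≥ 0`. [folklore] -/
theorem one_le_powCeil {e : ℝ} (he : 0 ≤ e) {n : ℕ} (hn : 1 ≤ n) : 1 ≤ powCeil e n := by
  unfold powCeil
  have h1 : (1 : ℝ) ≤ (n : ℝ) ^ e := Real.one_le_rpow (by exact_mod_cast hn) he
  exact_mod_cast h1.trans (Nat.le_ceil _)

/-- The eventual form used by the `headLang_mem_*` lemmas. [folklore] -/
theorem eventually_one_le_powCeil {e : ℝ} (he : 0 ≤ e) :
    ∃ n₁ : ℕ, ∀ n ≥ n₁, 1 ≤ powCeil e n :=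
  ⟨1, fun _ hn => one_le_powCeil he hn⟩

/-! ### The four hypotheses (one `ε`-instance each) and the two conclusions -/

/-- Hypothesis of **Thm. 1.1 item 2** at `ε` (`C = NP`): for every `β ∈ (0,1)` some `2^{n^β}`-sparse
`NP` language is outside `U₂-Formula-⊕[⌈n^{1+ε}⌉]` (a.e. class `FORMULAXORae`). OPEN lower bound —
a `Prop`, never asserted. [cite: ChenJinWilliams2019, Thm. 1.1 item 2 (hypothesis), TR19-118 p. 3] -/
def SparseNPFormulaXorHardAt (ε : ℝ) : Prop :=
  ∀ β : ℝ, 0 < β → β < 1 →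
    ∃ L : Language Bool, L ∈ NP ∧ IsSparse (expSparsity β) L ∧ L ∉ FORMULAXORae (powCeil (1 + ε))

/-- Hypothesis of **Thm. 1.1 item 3** at `ε` (`C = NP`): … outside `B₂-Formula[⌈n^{2+ε}⌉]` (a.e.
class `B2FORMULAae`). OPEN. [cite: ChenJinWilliams2019, Thm. 1.1 item 3 (hypothesis), TR19-118 p. 3] -/
def SparseNPB2FormulaHardAt (ε : ℝ) : Prop :=
  ∀ β : ℝ, 0 < β → β < 1 →
    ∃ L : Language Bool, L ∈ NP ∧ IsSparse (expSparsity β) L ∧ L ∉ B2FORMULAae (powCeil (2 + ε))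

/-- Hypothesis of **Thm. 1.1 item 4** at `ε` (`C = NP`): … outside `U₂-Formula[⌈n^{3+ε}⌉]` (a.e.
class `FORMULAae`, De Morgan leaf size). OPEN (Håstad/Tal give `n^{3−o(1)}` for dense functions).
[cite: ChenJinWilliams2019, Thm. 1.1 item 4 (hypothesis), TR19-118 p. 4] -/
def SparseNPFormulaHardAt (ε : ℝ) : Prop :=
  ∀ β : ℝ, 0 < β → β < 1 →
    ∃ L : Language Bool, L ∈ NP ∧ IsSparse (expSparsity β) L ∧ L ∉ FORMULAae (powCeil (3 + ε))

/-- Hypothesis of **Thm. 1.1 item 5** at `ε` (`C = NP`): … outside `BP[⌈n^{2+ε}⌉]` (a.e. class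
`BPSIZEae`, deterministic branching programs, inner nodes). OPEN (Nečiporuk gives `n^{2−o(1)}` for
dense functions). [cite: ChenJinWilliams2019, Thm. 1.1 item 5 (hypothesis), TR19-118 p. 4] -/
def SparseNPBPHardAt (ε : ℝ) : Prop :=
  ∀ β : ℝ, 0 < β → β < 1 →
    ∃ L : Language Bool, L ∈ NP ∧ IsSparse (expSparsity β) L ∧ L ∉ BPSIZEae (powCeil (2 + ε))

/-- "`NP ⊄ BP[n^k]` for all `k`": for every `k` some `NP` language is outside `BPSIZEae (n ↦ n^k)`
(the branching-program twin of `ChenJinWilliams2020.NPNotInFixedPolyFormulas`).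
[cite: ChenJinWilliams2019, Thm. 1.1 item 5 (conclusion)] -/
def NPNotInFixedPolyBP : Prop :=
  ∀ k : ℕ, ∃ L : Language Bool, L ∈ NP ∧ L ∉ BPSIZEae fun n => n ^ k

/-! ### The named facts: items 2–5 and their printed converses -/

/-- **Chen–Jin–Williams 2019, Theorem 1.1 item 2 (`C = NP`).** Printed (TR19-118 p. 3): *"2. L_β ∉
U₂-Formula-⊕[n^{1+ε}], then C ⊄ Formula[n^k] for all k."* Rendering: module docstring.
[cite: ChenJinWilliams2019, Thm. 1.1 item 2, TR19-118 p. 3] -/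
def thm11_item2_NP : Prop :=
  ∀ ε : ℝ, 0 < ε → SparseNPFormulaXorHardAt ε → ChenJinWilliams2020.NPNotInFixedPolyFormulas

/-- **Theorem 1.1, converse of item 2 (`C = NP`).** Printed (TR19-118 p. 4): *"Moreover, the
converse of each item above also holds, except for the last two."*
[cite: ChenJinWilliams2019, Thm. 1.1 (converse of item 2), TR19-118 p. 4] -/
def thm11_item2_NP_converse : Prop :=
  ChenJinWilliams2020.NPNotInFixedPolyFormulas → ∃ ε : ℝ, 0 < ε ∧ SparseNPFormulaXorHardAt ε

/-- **Chen–Jin–Williams 2019, Theorem 1.1 item 3 (`C = NP`).** Printed (TR19-118 p. 3): *"3. L_β ∉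
B₂-Formula[n^{2+ε}], then C ⊄ Formula[n^k] for all k."*
[cite: ChenJinWilliams2019, Thm. 1.1 item 3, TR19-118 p. 3] -/
def thm11_item3_NP : Prop :=
  ∀ ε : ℝ, 0 < ε → SparseNPB2FormulaHardAt ε → ChenJinWilliams2020.NPNotInFixedPolyFormulas

/-- **Theorem 1.1, converse of item 3 (`C = NP`).**
[cite: ChenJinWilliams2019, Thm. 1.1 (converse of item 3), TR19-118 p. 4] -/
def thm11_item3_NP_converse : Prop :=
  ChenJinWilliams2020.NPNotInFixedPolyFormulas → ∃ ε : ℝ, 0 < ε ∧ SparseNPB2FormulaHardAt ε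

/-- **Chen–Jin–Williams 2019, Theorem 1.1 item 4 (`C = NP`).** Printed (TR19-118 p. 4): *"4. L_β ∉
U₂-Formula[n^{3+ε}], then C ⊄ Formula[n^k] for all k."*
[cite: ChenJinWilliams2019, Thm. 1.1 item 4, TR19-118 p. 4] -/
def thm11_item4_NP : Prop :=
  ∀ ε : ℝ, 0 < ε → SparseNPFormulaHardAt ε → ChenJinWilliams2020.NPNotInFixedPolyFormulas

/-- **Theorem 1.1, converse of item 4 (`C = NP`).**
[cite: ChenJinWilliams2019, Thm. 1.1 (converse of item 4), TR19-118 p. 4] -/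
def thm11_item4_NP_converse : Prop :=
  ChenJinWilliams2020.NPNotInFixedPolyFormulas → ∃ ε : ℝ, 0 < ε ∧ SparseNPFormulaHardAt ε

/-- **Chen–Jin–Williams 2019, Theorem 1.1 item 5 (`C = NP`).** Printed (TR19-118 p. 4): *"5. L_β ∉
BP[n^{2+ε}], then C ⊄ BP[n^k] for all k."*
[cite: ChenJinWilliams2019, Thm. 1.1 item 5, TR19-118 p. 4] -/
def thm11_item5_NP : Prop :=
  ∀ ε : ℝ, 0 < ε → SparseNPBPHardAt ε → NPNotInFixedPolyBP

/-- **Theorem 1.1, converse of item 5 (`C = NP`).**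
[cite: ChenJinWilliams2019, Thm. 1.1 (converse of item 5), TR19-118 p. 4] -/
def thm11_item5_NP_converse : Prop :=
  NPNotInFixedPolyBP → ∃ ε : ℝ, 0 < ε ∧ SparseNPBPHardAt ε

/-! ### API: non-vacuity of the classes, antitonicity in `ε`, the "iff" packagings -/

/-- Non-vacuity (referee rule F1): the item-2 class at threshold `⌈n^{1+ε}⌉` is inhabited, so
"`L ∉ FORMULAXORae …`" is a genuine lower bound on `L`. [folklore] -/
theorem headLang_mem_FORMULAXORae_powCeil {e : ℝ} (he : 0 ≤ e) :
    headLang ∈ FORMULAXORae (powCeil e) :=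
  headLang_mem_FORMULAXORae (eventually_one_le_powCeil he)

/-- Non-vacuity of the item-3 class. [folklore] -/
theorem headLang_mem_B2FORMULAae_powCeil {e : ℝ} (he : 0 ≤ e) :
    headLang ∈ B2FORMULAae (powCeil e) :=
  OliveiraPichSanthanam2019.headLang_mem_B2FORMULAae (eventually_one_le_powCeil he)

/-- Non-vacuity of the item-4 class. [folklore] -/
theorem headLang_mem_FORMULAae_powCeil {e : ℝ} (he : 0 ≤ e) :
    headLang ∈ FORMULAae (powCeil e) :=
  headLang_mem_FORMULAae (eventually_one_le_powCeil he)

/-- Non-vacuity of the item-5 class. [folklore] -/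
theorem headLang_mem_BPSIZEae_powCeil {e : ℝ} (he : 0 ≤ e) :
    headLang ∈ BPSIZEae (powCeil e) :=
  headLang_mem_BPSIZEae (eventually_one_le_powCeil he)

/-- The conclusion classes are inhabited too (`n^k ≥ 1` for `n ≥ 1`). [folklore] -/
theorem headLang_mem_BPSIZEae_pow (k : ℕ) : headLang ∈ BPSIZEae fun n => n ^ k :=
  headLang_mem_BPSIZEae ⟨1, fun n hn => Nat.one_le_pow k n hn⟩

/-- Item-2 hypothesis is antitone in `ε` (a larger exponent is a bigger class to be outside of).
[folklore] -/
theorem SparseNPFormulaXorHardAt.anti {ε ε' : ℝ} (hε : 0 ≤ ε) (h : ε ≤ ε')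
    (hH : SparseNPFormulaXorHardAt ε') : SparseNPFormulaXorHardAt ε := by
  intro β hβ hβ1
  obtain ⟨L, hNP, hsp, hL⟩ := hH β hβ hβ1
  exact ⟨L, hNP, hsp, fun hmem => hL (FORMULAXORae_mono
    ⟨0, fun n _ => powCeil_mono (by linarith) (by linarith) n⟩ hmem)⟩

/-- Item-3 hypothesis is antitone in `ε`. [folklore] -/
theorem SparseNPB2FormulaHardAt.anti {ε ε' : ℝ} (hε : 0 ≤ ε) (h : ε ≤ ε')
    (hH : SparseNPB2FormulaHardAt ε') : SparseNPB2FormulaHardAt ε := by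
  intro β hβ hβ1
  obtain ⟨L, hNP, hsp, hL⟩ := hH β hβ hβ1
  exact ⟨L, hNP, hsp, fun hmem => hL (OliveiraPichSanthanam2019.B2FORMULAae_mono
    ⟨0, fun n _ => powCeil_mono (by linarith) (by linarith) n⟩ hmem)⟩

/-- Item-4 hypothesis is antitone in `ε`. [folklore] -/
theorem SparseNPFormulaHardAt.anti {ε ε' : ℝ} (hε : 0 ≤ ε) (h : ε ≤ ε')
    (hH : SparseNPFormulaHardAt ε') : SparseNPFormulaHardAt ε := by
  intro β hβ hβ1
  obtain ⟨L, hNP, hsp, hL⟩ := hH β hβ hβ1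
  exact ⟨L, hNP, hsp, fun hmem => hL (FORMULAae_mono
    ⟨0, fun n _ => powCeil_mono (by linarith) (by linarith) n⟩ hmem)⟩

/-- Item-5 hypothesis is antitone in `ε`. [folklore] -/
theorem SparseNPBPHardAt.anti {ε ε' : ℝ} (hε : 0 ≤ ε) (h : ε ≤ ε')
    (hH : SparseNPBPHardAt ε') : SparseNPBPHardAt ε := by
  intro β hβ hβ1
  obtain ⟨L, hNP, hsp, hL⟩ := hH β hβ hβ1
  exact ⟨L, hNP, hsp, fun hmem => hL (BPSIZEae_mono
    ⟨0, fun n _ => powCeil_mono (by linarith) (by linarith) n⟩ hmem)⟩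

/-- A `U₂`-formula lower bound is in particular a `U₂-Formula-⊕` … no: the inclusion goes the other
way (`FORMULAae s ⊆ FORMULAXORae s`), so hardness against `Formula-⊕[s]` IMPLIES hardness against
`Formula[s]` at the SAME `s` — recorded at the thresholds of items 2 and 4 only as this same-`s`
transfer (item 2's `n^{1+ε}` is far below item 4's `n^{3+ε}`; the two hypotheses are related only
through the facts and their converses, `formulaXorHard_iff_formulaHard`). [folklore] -/
theorem not_mem_FORMULAae_of_not_mem_FORMULAXORae {L : Language Bool} {s : ℕ → ℕ}
    (h : L ∉ FORMULAXORae s) : L ∉ FORMULAae s :=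
  fun hm => h (FORMULAae_subset_FORMULAXORae s hm)

/-- Likewise `FORMULAae s ⊆ B2FORMULAae s`: hardness against `B₂` formulas implies hardness against
De Morgan formulas of the same size. [folklore] -/
theorem not_mem_FORMULAae_of_not_mem_B2FORMULAae {L : Language Bool} {s : ℕ → ℕ}
    (h : L ∉ B2FORMULAae s) : L ∉ FORMULAae s :=
  fun hm => h (OliveiraPichSanthanam2019.FORMULAae_subset_B2FORMULAae s hm)

/-- Item 2 with its converse: the hypothesis (at some `ε > 0`) is EQUIVALENT to
`NP ⊄ Formula[n^k] ∀ k` — census row R48 is an "⟺" row.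
[cite: ChenJinWilliams2019, Thm. 1.1 item 2 and its converse] -/
theorem sparseNPFormulaXorHard_iff (h : thm11_item2_NP) (h' : thm11_item2_NP_converse) :
    (∃ ε : ℝ, 0 < ε ∧ SparseNPFormulaXorHardAt ε) ↔ ChenJinWilliams2020.NPNotInFixedPolyFormulas :=
  ⟨fun ⟨ε, hε, hH⟩ => h ε hε hH, h'⟩

/-- Item 3 with its converse. [cite: ChenJinWilliams2019, Thm. 1.1 item 3 and its converse] -/
theorem sparseNPB2FormulaHard_iff (h : thm11_item3_NP) (h' : thm11_item3_NP_converse) :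
    (∃ ε : ℝ, 0 < ε ∧ SparseNPB2FormulaHardAt ε) ↔ ChenJinWilliams2020.NPNotInFixedPolyFormulas :=
  ⟨fun ⟨ε, hε, hH⟩ => h ε hε hH, h'⟩

/-- Item 4 with its converse. [cite: ChenJinWilliams2019, Thm. 1.1 item 4 and its converse] -/
theorem sparseNPFormulaHard_iff (h : thm11_item4_NP) (h' : thm11_item4_NP_converse) :
    (∃ ε : ℝ, 0 < ε ∧ SparseNPFormulaHardAt ε) ↔ ChenJinWilliams2020.NPNotInFixedPolyFormulas :=
  ⟨fun ⟨ε, hε, hH⟩ => h ε hε hH, h'⟩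

/-- Item 5 with its converse: equivalent to `NP ⊄ BP[n^k] ∀ k`.
[cite: ChenJinWilliams2019, Thm. 1.1 item 5 and its converse] -/
theorem sparseNPBPHard_iff (h : thm11_item5_NP) (h' : thm11_item5_NP_converse) :
    (∃ ε : ℝ, 0 < ε ∧ SparseNPBPHardAt ε) ↔ NPNotInFixedPolyBP :=
  ⟨fun ⟨ε, hε, hH⟩ => h ε hε hH, h'⟩

/-- Through the facts, the three formula hypotheses (items 2, 3, 4, each at some `ε > 0`) are
mutually equivalent — e.g. items 2 and 4: a `Formula-⊕[n^{1+ε}]` bound for sparse `NP` languages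
exists iff a `U₂-Formula[n^{3+ε'}]` bound does. [cite: ChenJinWilliams2019, Thm. 1.1 items 2, 4 and
their converses] -/
theorem formulaXorHard_iff_formulaHard (h₂ : thm11_item2_NP) (h₂' : thm11_item2_NP_converse)
    (h₄ : thm11_item4_NP) (h₄' : thm11_item4_NP_converse) :
    (∃ ε : ℝ, 0 < ε ∧ SparseNPFormulaXorHardAt ε) ↔ (∃ ε : ℝ, 0 < ε ∧ SparseNPFormulaHardAt ε) :=
  (sparseNPFormulaXorHard_iff h₂ h₂').trans (sparseNPFormulaHard_iff h₄ h₄').symm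

/-- Items 3 and 4 likewise. [cite: ChenJinWilliams2019, Thm. 1.1 items 3, 4 and their converses] -/
theorem b2FormulaHard_iff_formulaHard (h₃ : thm11_item3_NP) (h₃' : thm11_item3_NP_converse)
    (h₄ : thm11_item4_NP) (h₄' : thm11_item4_NP_converse) :
    (∃ ε : ℝ, 0 < ε ∧ SparseNPB2FormulaHardAt ε) ↔ (∃ ε : ℝ, 0 < ε ∧ SparseNPFormulaHardAt ε) :=
  (sparseNPB2FormulaHard_iff h₃ h₃').trans (sparseNPFormulaHard_iff h₄ h₄').symm

end Literature.Computability.MetaComplexity.ChenJinWilliams2019
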